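import Summits.ABC.IUTFork.LanaPadicPairAutomorphisms
import HarnessLib

/-!
# L-LANA objects IX octies — vacuity audit: the pair `(G_{ℚ_p} ↷ O^▷_{ℚ̄_p})` HAS automorphisms, and on Galois ones `ψ_e` IS the field automorphism

Record-only companion (D-0012; seat abc-iut-c312-4 gen 6; the cell's "vacuity-audit every fork-level hypothesis
with a non-vacuity witness" duty, LANA Rem. 8.2.1) of `LanaPadicPairAutomorphisms.lean` /
`LanaCyclotomicRigidityNatural.lean`, whose theorems quantify over ALL automorphisms
`e : GaloisMonoidPair.Iso (padicPair p) (padicPair p)` of the `ℚ_p` reference pair.  TAKES NO SIDE on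
[IUTchIII] Cor. 3.12.

* `PadicPairIso.ofGal σ` — every `σ ∈ G_{ℚ_p}` IS such an automorphism (conjugation on `G_{ℚ_p}`, `σ · ` on
  `O^▷_{ℚ̄_p}`; layer L4's `GaloisMonoidPair.Iso.conj`, [AbsTopIII] Prop. 3.2 (iv) proof "inner automorphisms"),
  so the quantifier is NOT vacuous and not trivial: `exists_iso_isoM_ne` — some automorphism moves some element
  of `O^▷` (were every `σ ∈ G_{ℚ_p}` to fix `O^▷`, it would fix `ℚ̄_p`, so `√p ∈ ℚ_p` — but `v_p(p) = 1` is odd);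
* **`PadicPairIso.coe_extEquiv_ofGal`** — on these GEOMETRIC automorphisms the extension `ψ_e : ℚ̄_pˣ ⥲ ℚ̄_pˣ` of
  gen 6 is `σ` itself (`ψ_{(inn σ, σ)}(x) = σ(x)` for every `x ∈ ℚ̄_pˣ`): the construction recovers the field
  automorphism, as it must;
* `galComponent_ofGal` — and its `G`-component is conjugation by `σ`.

What this does NOT exhibit: an EXOTIC automorphism (one whose `G`-component is not inner / not induced by a field
automorphism — [AbsTopIII] Introduction, NSW XII); the tree has no such construction, and none is claimed.
[cite: LANA2026Report, Rem. 8.2.1 p. 42, Def. 3.7.1 p. 20] [cite: MochizukiAbsTopIII2015, Proposition 3.2 (iv) p.72]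
NOT here: any judgement.
-/

noncomputable section

namespace Summit.ABC
namespace IUTFork
namespace PadicPairIso

open Literature.AnabelianGeometry.AbsoluteAnabelian Field
open scoped NNReal

variable (p : ℕ) [Fact p.Prime]

/-- **Every `σ ∈ G_{ℚ_p}` is an automorphism of the pair `(G_{ℚ_p} ↷ O^▷_{ℚ̄_p})`** (conjugation on the group,
`σ · ` on the monoid; layer L4's `Iso.conj`). [cite: MochizukiAbsTopIII2015, Proposition 3.2 (iv) p.72] -/
abbrev ofGal (σ : PadicGal p) : GaloisMonoidPair.Iso (padicPair p) (padicPair p) :=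
  GaloisMonoidPair.Iso.conj (padicPair p) σ

/-- Its monoid component is `a ↦ σ a`. [cite: MochizukiAbsTopIII2015, Proposition 3.2 (iv) p.72] -/
theorem coe_ofGal_isoM (σ : PadicGal p) (a : intMonoid (padicVal p)) :
    (((ofGal p σ).isoM a : intMonoid (padicVal p)) : PadicAlgCl p) = σ (a : PadicAlgCl p) := rfl

/-- Its group component, read on `Field.absoluteGaloisGroup ℚ_[p]`, is conjugation by `σ`.
[cite: MochizukiAbsTopIII2015, Proposition 3.2 (iv) p.72] -/
theorem galComponent_ofGal (σ : PadicGal p) (τ : absoluteGaloisGroup ℚ_[p]) :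
    galComponent p (ofGal p σ) τ = padicGalAbs p (σ * (padicGalAbs p).symm τ * σ⁻¹) := rfl

/-- The quantifier "every automorphism of the pair" is inhabited. [cite: LANA2026Report, Rem. 8.2.1 p. 42] -/
theorem nonempty_iso : Nonempty (GaloisMonoidPair.Iso (padicPair p) (padicPair p)) := ⟨ofGal p 1⟩

/-- **… and not trivially so**: some automorphism of the pair moves some element of `O^▷_{ℚ̄_p}` — `G_{ℚ_p} ≠ 1`
(there is `σ ≠ 1`: `ℚ̄_p ≠ ℚ_p`, e.g. `√p ∉ ℚ_p`; `G_{ℚ_p}` acts faithfully) and a non-trivial `σ` moves some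
`x ∈ ℚ̄_p`, hence some `pⁿx ∈ O^▷`. [cite: LANA2026Report, Rem. 8.2.1 p. 42] -/
theorem exists_iso_isoM_ne :
    ∃ (e : GaloisMonoidPair.Iso (padicPair p) (padicPair p)) (a : intMonoid (padicVal p)), e.isoM a ≠ a := by
  classical
  -- a non-trivial element of `G_{ℚ_p}`: otherwise every element of `ℚ̄_p` is fixed, i.e. lies in `ℚ_p`,
  -- in particular a square root of `p` — but `p` is not a square in `ℚ_p` (odd valuation).
  by_contra h
  push Not at h
  have hfix : ∀ (σ : PadicGal p) (x : PadicAlgCl p), σ x = x := by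
    intro σ x
    by_cases hx : x = 0
    · rw [hx, map_zero]
    obtain ⟨n, hn⟩ := exists_pow_mul_mem_intMonoid p (Units.mk0 x hx)
    have ha : σ ((p : PadicAlgCl p) ^ n * x) = (p : PadicAlgCl p) ^ n * x :=
      congrArg (fun c : intMonoid (padicVal p) => (c : PadicAlgCl p)) (h (ofGal p σ) ⟨_, hn⟩)
    rw [map_mul, map_pow, map_natCast] at ha
    have hp0 : ((p : PadicAlgCl p) ^ n) ≠ 0 := pow_ne_zero _ (by exact_mod_cast (Fact.out : p.Prime).ne_zero)
    exact mul_left_cancel₀ hp0 ha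
  -- a square root of `p` in `ℚ̄_p`
  obtain ⟨r, hr⟩ := IsAlgClosed.exists_pow_nat_eq (p : PadicAlgCl p) two_pos
  obtain ⟨r₀, hr₀⟩ := (fixed_iff_mem_range p r).mp (fun σ => by rw [AlgEquiv.smul_def]; exact hfix σ r)
  have hsq : r₀ ^ 2 = (p : ℚ_[p]) := by
    apply (algebraMap ℚ_[p] (PadicAlgCl p)).injective
    rw [map_pow, hr₀, hr, map_natCast]
  -- valuations: `2 · v(r₀) = v(p) = 1`, impossible
  have hv := congrArg Padic.valuation hsq
  rw [Padic.valuation_pow, Padic.valuation_natCast, padicValNat.self (Fact.out : p.Prime).one_lt] at hv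
  omega

/-- **On Galois automorphisms `ψ_e` IS the field automorphism**: for `e = (inn σ, σ)` the extension
`extEquiv e : ℚ̄_pˣ ⥲ ℚ̄_pˣ` of gen 6 is `x ↦ σ x` (write `x = a/pⁿ` with `a ∈ O^▷`; `ψ_e(x) = σ(a)/σ(p)ⁿ = σ(x)`).
[cite: LANA2026Report, Def. 3.7.1 p. 20] [cite: MochizukiAbsTopIII2015, Proposition 3.2 (iv) p.72] -/
theorem coe_extEquiv_ofGal (σ : PadicGal p) (x : (PadicAlgCl p)ˣ) :
    ((extEquiv p (ofGal p σ) x : (PadicAlgCl p)ˣ) : PadicAlgCl p) = σ (x : PadicAlgCl p) := by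
  have hx := coe_mul_pInt_pow_liftExp p x
  rw [extEquiv_apply, extHom_apply, extFun_eq_of_mul_eq p (ofGal p σ) hx, Units.val_mul, Units.val_inv_eq_inv_val,
    coe_isoMUnits, coe_isoMUnits, coe_ofGal_isoM, coe_ofGal_isoM, ← hx, map_mul,
    mul_inv_cancel_right₀]
  rw [SubmonoidClass.coe_pow, coe_pInt, map_pow, map_natCast]
  exact pow_ne_zero _ (by exact_mod_cast (Fact.out : p.Prime).ne_zero)

/-- Hence on Galois automorphisms the valuation-preservation theorem `norm_extEquiv` of gen 6 reduces to the
isometry of `G_{ℚ_p}` on `ℚ̄_p` (gen 0 `norm_galois`) — a consistency check of the two routes. [folklore] -/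
theorem norm_extEquiv_ofGal (σ : PadicGal p) (x : (PadicAlgCl p)ˣ) :
    ‖((extEquiv p (ofGal p σ) x : (PadicAlgCl p)ˣ) : PadicAlgCl p)‖ = ‖(x : PadicAlgCl p)‖ := by
  rw [coe_extEquiv_ofGal, norm_galois]

end PadicPairIso
end IUTFork
end Summit.ABC

end
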